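import Literature.NumberTheory.QuadraticFields.ThreeTorsionMean
import Literature.NumberTheory.QuadraticFields.ThreeTorsionMeanSquarefreeCount
import HarnessLib

/-!
# Counting fundamental discriminants in a progression `a (mod m)`, `(2a, m) = 1`

Theorems-only companion of `ThreeTorsionMean.lean` (progressions; the unrestricted count is in
`ThreeTorsionMeanProofs.lean`). The `Σ 1` part of the
Davenport–Heilbronn / Taniguchi–Thorne decomposition behind
`Literature.NumberTheory.QuadraticFields.tt_threeTorsion_sum_progression` (Taniguchi–Thorne 2013,
Thm 6; §6.1: `Σ_D #Cl₃(D) = Σ_D 1 + 2 · #{nowhere totally ramified cubic fields}`, eq. (6.1)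
"`- (3/π²) X + O(X^{1/2})`", and Lemma 21 for progressions): for `m` odd and `gcd(a, m) = 1`,

`|#{D ∈ negFundDiscrs X : D ≡ a (mod m)} - (3/(π² m)) Π_{p ∣ m} (1 - p⁻²)⁻¹ X| ≤ 18 √X` (`X ≥ 1`),

and the same for `posFundDiscrs` (`ThreeTorsionMeanProgressionCountPos.lean`). PROVED, by the 2-adic
trichotomy of fundamental discriminants (`D ≡ 1 (4)` squarefree; `D = 4d`, `d ≡ 3 (4)` squarefree;
`D = 8k`, `k` odd squarefree), the Chinese remainder theorem, and the squarefree count in a coprime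
class `abs_card_squarefree_modEq_sub_le` (`ThreeTorsionMeanSquarefreeCount.lean`); the three
pieces have densities `g/(4m)`, `g/(16m)`, `g/(16m)` with `g = (8/π²) Π_{p ∣ m} (1 - p⁻²)⁻¹`.

## References
* T. Taniguchi, F. Thorne, *Secondary terms in counting functions for cubic fields*, Duke Math. J.
  162 (2013), Thm 6, §6.1, Lemma 21 [TaniguchiThorne2013].
-/

noncomputable section

open Finset
open scoped ArithmeticFunction.Moebius

namespace Literature.NumberTheory.QuadraticFields

/-! ### Coprimality bookkeeping and residue packaging -/

/-- `x ≡ r (mod n)` and `(r, n) = 1` imply `(x, n) = 1`. [folklore] -/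
theorem isCoprime_of_modEq {x r n : ℤ} (h : x ≡ r [ZMOD n]) (hr : IsCoprime r n) :
    IsCoprime x n := by
  obtain ⟨u, v, huv⟩ := hr
  obtain ⟨t, ht⟩ := Int.modEq_iff_dvd.1 h
  exact ⟨u, v + u * t, by linear_combination huv - u * ht⟩

/-- **Residue packaging (CRT).** For coprime moduli `q`, `m`, a residue `r` coprime to `q`, a
multiplier `s` coprime to `m` and `a` coprime to `m`, the conditions `x ≡ r (mod q)`,
`s x ≡ a (mod m)` describe one residue class `c (mod q m)` with `gcd(c, q m) = 1`. [folklore] -/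
theorem exists_residue_modEq_iff {q m : ℕ} (hqm : q.Coprime m) {r s a : ℤ} (hr : IsCoprime r q)
    (hs : IsCoprime s m) (ha : IsCoprime a m) :
    ∃ c : ℤ, Int.gcd c ((q * m : ℕ) : ℤ) = 1 ∧
      ∀ x : ℤ, x ≡ c [ZMOD ((q * m : ℕ) : ℤ)] ↔ (x ≡ r [ZMOD q] ∧ s * x ≡ a [ZMOD m]) := by
  obtain ⟨y, w, hyw⟩ := hs
  obtain ⟨c, hcq, hcm⟩ := exists_modEq_and_modEq_of_coprime hqm r (y * a)
  have hys : y * s ≡ 1 [ZMOD m] := Int.modEq_iff_dvd.2 ⟨w, by linear_combination (-1) * hyw⟩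
  refine ⟨c, ?_, fun x => ?_⟩
  · rw [← Int.isCoprime_iff_gcd_eq_one, Nat.cast_mul]
    refine IsCoprime.mul_right (isCoprime_of_modEq hcq hr) (isCoprime_of_modEq hcm ?_)
    exact IsCoprime.mul_left ⟨s, w, by linear_combination hyw⟩ ha
  · rw [Nat.cast_mul, ← Int.modEq_and_modEq_iff_modEq_mul (by simpa using hqm)]
    constructor
    · rintro ⟨h1, h2⟩
      refine ⟨h1.trans hcq, ?_⟩
      have h3 : s * x ≡ s * (y * a) [ZMOD m] := (h2.trans hcm).mul_left s
      calc s * x ≡ s * (y * a) [ZMOD m] := h3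
        _ = (y * s) * a := by ring
        _ ≡ 1 * a [ZMOD m] := hys.mul_right a
        _ = a := one_mul a
    · rintro ⟨h1, h2⟩
      refine ⟨h1.trans hcq.symm, ?_⟩
      have h3 : y * (s * x) ≡ y * a [ZMOD m] := h2.mul_left y
      have h4 : x ≡ y * a [ZMOD m] := by
        calc x = 1 * x := (one_mul x).symm
          _ ≡ (y * s) * x [ZMOD m] := (hys.mul_right x).symm
          _ = y * (s * x) := by ring
          _ ≡ y * a [ZMOD m] := h3
      exact h4.trans hcm.symm

/-! ### Squarefree and the prime `2`; the 2-adic trichotomy of fundamental discriminants -/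

/-- For odd `k`: `2k` is squarefree iff `k` is. [folklore] -/
theorem squarefree_two_mul_iff_of_odd {k : ℤ} (hk : k % 2 = 1) :
    Squarefree (2 * k) ↔ Squarefree k := by
  rw [← Int.squarefree_natAbs, ← Int.squarefree_natAbs (n := k), Int.natAbs_mul]
  have h2 : (2 : ℤ).natAbs = 2 := rfl
  rw [h2, Nat.squarefree_mul_iff]
  have hodd : Odd k.natAbs := by rw [Int.natAbs_odd]; exact Int.odd_iff.2 hk
  have hcop : Nat.Coprime 2 k.natAbs := Nat.coprime_two_left.2 hodd
  exact ⟨fun h => h.2.2, fun h => ⟨hcop, Nat.prime_two.prime.squarefree, h⟩⟩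

/-- **2-adic trichotomy** of the fundamental-discriminant condition of `negFundDiscrs` /
`posFundDiscrs`: `D ≡ 1 (mod 4)` squarefree (`≠ 1`), or `D = 4d` with `d ≡ 3 (mod 4)` squarefree,
or `D = 8k` with `k` odd squarefree. [folklore] -/
theorem fundDiscr_cond_iff (D : ℤ) :
    ((D % 4 = 1 ∧ Squarefree D ∧ D ≠ 1) ∨
      (4 ∣ D ∧ (D / 4 % 4 = 2 ∨ D / 4 % 4 = 3) ∧ Squarefree (D / 4))) ↔
    ((D % 4 = 1 ∧ Squarefree D ∧ D ≠ 1) ∨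
      (∃ d : ℤ, D = 4 * d ∧ d % 4 = 3 ∧ Squarefree d) ∨
      (∃ k : ℤ, D = 8 * k ∧ k % 2 = 1 ∧ Squarefree k)) := by
  refine or_congr_right ?_
  constructor
  · rintro ⟨h4, h23, hsq⟩
    rcases h23 with h2 | h3
    · right
      refine ⟨D / 8, by omega, by omega, ?_⟩
      have hD : D / 4 = 2 * (D / 8) := by omega
      rwa [hD, squarefree_two_mul_iff_of_odd (by omega)] at hsq
    · left
      exact ⟨D / 4, by omega, h3, hsq⟩
  · rintro (⟨d, rfl, hd3, hsq⟩ | ⟨k, rfl, hk, hsq⟩)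
    · refine ⟨⟨d, rfl⟩, Or.inr (by omega), ?_⟩
      have : 4 * d / 4 = d := by omega
      rwa [this]
    · refine ⟨⟨2 * k, by ring⟩, Or.inl (by omega), ?_⟩
      have : 8 * k / 4 = 2 * k := by omega
      rw [this, squarefree_two_mul_iff_of_odd hk]; exact hsq

/-! ### Negative fundamental discriminants in a progression: decomposition -/

/-- The set `{D ∈ negFundDiscrs X : D ≡ a (mod m)}` split by 2-adic type, each type written as a
(scaled) set of squarefree integers in ONE residue class: type I `D ≡ c₁ (mod 4m)`, type II
`D = 4d`, `d ≡ c₂ (mod 4m)`, type III `D = 8k`, `k ≡ c₃ (mod 2m)`. [folklore] -/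
theorem negFundDiscrs_filter_modEq_eq {m : ℕ} {a c₁ c₂ c₃ : ℤ} (X : ℕ)
    (h₁ : ∀ x : ℤ, x ≡ c₁ [ZMOD ((4 * m : ℕ) : ℤ)] ↔ (x ≡ 1 [ZMOD (4 : ℕ)] ∧ 1 * x ≡ a [ZMOD m]))
    (h₂ : ∀ x : ℤ, x ≡ c₂ [ZMOD ((4 * m : ℕ) : ℤ)] ↔ (x ≡ 3 [ZMOD (4 : ℕ)] ∧ 4 * x ≡ a [ZMOD m]))
    (h₃ : ∀ x : ℤ, x ≡ c₃ [ZMOD ((2 * m : ℕ) : ℤ)] ↔ (x ≡ 1 [ZMOD (2 : ℕ)] ∧ 8 * x ≡ a [ZMOD m])) :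
    (negFundDiscrs X).filter (fun D => D ≡ a [ZMOD m]) =
      (Ico (1 - (X : ℤ)) 0).filter (fun x => x ≡ c₁ [ZMOD ((4 * m : ℕ) : ℤ)] ∧ Squarefree x) ∪
      ((((Ico (-(((X : ℤ) - 1) / 4)) 0).filter
          (fun x => x ≡ c₂ [ZMOD ((4 * m : ℕ) : ℤ)] ∧ Squarefree x)).image (fun d => 4 * d)) ∪
       (((Ico (-(((X : ℤ) - 1) / 8)) 0).filter
          (fun x => x ≡ c₃ [ZMOD ((2 * m : ℕ) : ℤ)] ∧ Squarefree x)).image (fun k => 8 * k))) := by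
  ext D
  simp only [Finset.mem_union, Finset.mem_filter, Finset.mem_image, Finset.mem_Ico,
    mem_negFundDiscrs, fundDiscr_cond_iff, h₁, h₂, h₃]
  simp only [Nat.cast_ofNat, one_mul, Int.ModEq, Int.reduceMod]
  constructor
  · rintro ⟨⟨⟨hlo, hhi⟩, hcases⟩, hmod⟩
    rcases hcases with ⟨hD4, hsq, -⟩ | ⟨d, rfl, hd3, hsq⟩ | ⟨k, rfl, hk, hsq⟩
    · exact Or.inl ⟨⟨by omega, hhi⟩, ⟨hD4, hmod⟩, hsq⟩
    · exact Or.inr (Or.inl ⟨d, ⟨⟨by omega, by omega⟩, ⟨hd3, hmod⟩, hsq⟩, rfl⟩)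
    · exact Or.inr (Or.inr ⟨k, ⟨⟨by omega, by omega⟩, ⟨hk, hmod⟩, hsq⟩, rfl⟩)
  · rintro (⟨⟨hlo, hhi⟩, ⟨hD4, hmod⟩, hsq⟩ | ⟨d, ⟨⟨hlo, hhi⟩, ⟨hd3, hmod⟩, hsq⟩, rfl⟩ |
        ⟨k, ⟨⟨hlo, hhi⟩, ⟨hk, hmod⟩, hsq⟩, rfl⟩)
    · exact ⟨⟨⟨by omega, hhi⟩, Or.inl ⟨hD4, hsq, by omega⟩⟩, hmod⟩
    · exact ⟨⟨⟨by omega, by omega⟩, Or.inr (Or.inl ⟨d, rfl, hd3, hsq⟩)⟩, hmod⟩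
    · exact ⟨⟨⟨by omega, by omega⟩, Or.inr (Or.inr ⟨k, rfl, hk, hsq⟩)⟩, hmod⟩

/-- The cardinality version of `negFundDiscrs_filter_modEq_eq`: the three pieces are disjoint and
the scalings `d ↦ 4d`, `k ↦ 8k` are injective. [folklore] -/
theorem card_negFundDiscrs_filter_modEq_eq {m : ℕ} {a c₁ c₂ c₃ : ℤ} (X : ℕ)
    (h₁ : ∀ x : ℤ, x ≡ c₁ [ZMOD ((4 * m : ℕ) : ℤ)] ↔ (x ≡ 1 [ZMOD (4 : ℕ)] ∧ 1 * x ≡ a [ZMOD m]))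
    (h₂ : ∀ x : ℤ, x ≡ c₂ [ZMOD ((4 * m : ℕ) : ℤ)] ↔ (x ≡ 3 [ZMOD (4 : ℕ)] ∧ 4 * x ≡ a [ZMOD m]))
    (h₃ : ∀ x : ℤ, x ≡ c₃ [ZMOD ((2 * m : ℕ) : ℤ)] ↔ (x ≡ 1 [ZMOD (2 : ℕ)] ∧ 8 * x ≡ a [ZMOD m])) :
    ((negFundDiscrs X).filter (fun D => D ≡ a [ZMOD m])).card =
      ((Ico (1 - (X : ℤ)) 0).filter (fun x => x ≡ c₁ [ZMOD ((4 * m : ℕ) : ℤ)] ∧ Squarefree x)).card +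
      ((Ico (-(((X : ℤ) - 1) / 4)) 0).filter
          (fun x => x ≡ c₂ [ZMOD ((4 * m : ℕ) : ℤ)] ∧ Squarefree x)).card +
      ((Ico (-(((X : ℤ) - 1) / 8)) 0).filter
          (fun x => x ≡ c₃ [ZMOD ((2 * m : ℕ) : ℤ)] ∧ Squarefree x)).card := by
  rw [negFundDiscrs_filter_modEq_eq X h₁ h₂ h₃]
  have hmem₁ : ∀ D ∈ (Ico (1 - (X : ℤ)) 0).filter
      (fun x => x ≡ c₁ [ZMOD ((4 * m : ℕ) : ℤ)] ∧ Squarefree x), D % 4 = 1 := by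
    intro D hD
    rw [Finset.mem_filter, h₁] at hD
    have := hD.2.1.1
    simp only [Nat.cast_ofNat, Int.ModEq, Int.reduceMod] at this
    exact this
  have hmem₂ : ∀ D ∈ ((Ico (-(((X : ℤ) - 1) / 4)) 0).filter
      (fun x => x ≡ c₂ [ZMOD ((4 * m : ℕ) : ℤ)] ∧ Squarefree x)).image (fun d => 4 * d),
      D % 16 = 12 := by
    intro D hD
    rw [Finset.mem_image] at hD
    obtain ⟨d, hd, rfl⟩ := hD
    rw [Finset.mem_filter, h₂] at hd
    have := hd.2.1.1
    simp only [Nat.cast_ofNat, Int.ModEq, Int.reduceMod] at this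
    omega
  have hmem₃ : ∀ D ∈ ((Ico (-(((X : ℤ) - 1) / 8)) 0).filter
      (fun x => x ≡ c₃ [ZMOD ((2 * m : ℕ) : ℤ)] ∧ Squarefree x)).image (fun k => 8 * k),
      D % 16 = 8 := by
    intro D hD
    rw [Finset.mem_image] at hD
    obtain ⟨k, hk, rfl⟩ := hD
    rw [Finset.mem_filter, h₃] at hk
    have := hk.2.1.1
    simp only [Nat.cast_ofNat, Int.ModEq, Int.reduceMod] at this
    omega
  have hdisj₂₃ : Disjoint
      (((Ico (-(((X : ℤ) - 1) / 4)) 0).filter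
          (fun x => x ≡ c₂ [ZMOD ((4 * m : ℕ) : ℤ)] ∧ Squarefree x)).image (fun d => 4 * d))
      (((Ico (-(((X : ℤ) - 1) / 8)) 0).filter
          (fun x => x ≡ c₃ [ZMOD ((2 * m : ℕ) : ℤ)] ∧ Squarefree x)).image (fun k => 8 * k)) := by
    rw [Finset.disjoint_left]
    intro D hD hD'
    have h2 := hmem₂ D hD
    have h3 := hmem₃ D hD'
    omega
  have hdisj₁ : Disjoint
      ((Ico (1 - (X : ℤ)) 0).filter (fun x => x ≡ c₁ [ZMOD ((4 * m : ℕ) : ℤ)] ∧ Squarefree x))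
      ((((Ico (-(((X : ℤ) - 1) / 4)) 0).filter
          (fun x => x ≡ c₂ [ZMOD ((4 * m : ℕ) : ℤ)] ∧ Squarefree x)).image (fun d => 4 * d)) ∪
       (((Ico (-(((X : ℤ) - 1) / 8)) 0).filter
          (fun x => x ≡ c₃ [ZMOD ((2 * m : ℕ) : ℤ)] ∧ Squarefree x)).image (fun k => 8 * k))) := by
    rw [Finset.disjoint_left]
    intro D hD hD'
    have h1 := hmem₁ D hD
    rcases Finset.mem_union.1 hD' with h | h
    · have h2 := hmem₂ D h; omega
    · have h3 := hmem₃ D h; omega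
  rw [Finset.card_union_of_disjoint hdisj₁, Finset.card_union_of_disjoint hdisj₂₃,
    Finset.card_image_of_injective _ (mul_right_injective₀ (by norm_num : (4 : ℤ) ≠ 0)),
    Finset.card_image_of_injective _ (mul_right_injective₀ (by norm_num : (8 : ℤ) ≠ 0)),
    Nat.add_assoc]

/-! ### Negative fundamental discriminants in a progression: the count -/

/-- `Π_{p ∣ 2ᵏ m} (1 - p⁻²)⁻¹ = (4/3) Π_{p ∣ m} (1 - p⁻²)⁻¹` for `m` odd, `k ≥ 1`. [folklore] -/
theorem prod_primeFactors_two_pow_mul {m : ℕ} (hm : Odd m) {k : ℕ} (hk : k ≠ 0) :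
    ∏ p ∈ (2 ^ k * m).primeFactors, (1 - 1 / (p : ℝ) ^ 2)⁻¹ =
      4 / 3 * ∏ p ∈ m.primeFactors, (1 - 1 / (p : ℝ) ^ 2)⁻¹ := by
  have h2 : 2 ∉ m.primeFactors := fun h =>
    (Nat.not_even_iff_odd.2 hm) (even_iff_two_dvd.2 (Nat.dvd_of_mem_primeFactors h))
  rw [Nat.Coprime.primeFactors_mul ((Nat.coprime_two_left.2 hm).pow_left k),
    Nat.primeFactors_prime_pow hk Nat.prime_two, ← Finset.insert_eq, Finset.prod_insert h2]
  norm_num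

/-- `0 ≤ (6/π²) Π_{p ∣ L} (1 - p⁻²)⁻¹ ≤ 2` (it is `Σ_{(d,L)=1} μ(d)/d² ∈ [0, 2]` crudely, by the
tail bound with `k = 1`; in truth it lies in `(0, 1]`). [folklore] -/
theorem density_le_two {L : ℕ} (hL : L ≠ 0) :
    6 / Real.pi ^ 2 * ∏ p ∈ L.primeFactors, (1 - 1 / (p : ℝ) ^ 2)⁻¹ ≤ 2 := by
  have h := abs_sub_sum_range_moebius_coprime_div_sq_le hL (le_refl 1)
  simp only [Finset.range_one, Finset.sum_singleton, Nat.cast_zero, Nat.cast_one, div_one] at h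
  have h0 : (if Nat.Coprime 0 L then ((μ 0 : ℤ) : ℝ) / (0 : ℝ) ^ 2 else 0) = 0 := by simp
  rw [h0, sub_zero] at h
  exact (le_abs_self _).trans h

/-- `0 ≤ (6/π²) Π_{p ∣ L} (1 - p⁻²)⁻¹`. [folklore] -/
theorem density_nonneg (L : ℕ) :
    0 ≤ 6 / Real.pi ^ 2 * ∏ p ∈ L.primeFactors, (1 - 1 / (p : ℝ) ^ 2)⁻¹ := by
  refine mul_nonneg (by positivity) (Finset.prod_nonneg fun p hp => ?_)
  have hp2 : (2 : ℝ) ≤ p := by exact_mod_cast (Nat.prime_of_mem_primeFactors hp).two_le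
  have : 1 / (p : ℝ) ^ 2 ≤ 1 / 4 := one_div_le_one_div_of_le (by norm_num) (by nlinarith)
  exact inv_nonneg.2 (by linarith)

/-- **Negative fundamental discriminants in a progression.** For `m` odd, `gcd(a, m) = 1` and
`X ≥ 1`: `|#{D ∈ negFundDiscrs X : D ≡ a (mod m)} - (3/(π² m)) Π_{p ∣ m} (1 - p⁻²)⁻¹ · X| ≤ 18 √X`
(the number of imaginary quadratic fields with `|Disc| < X` and `Disc ≡ a (mod m)`; cf.
Taniguchi–Thorne, Lemma 21 and §6.1). [cite: TaniguchiThorne2013, Lemma 21 and §6.1] -/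
theorem abs_card_negFundDiscrs_filter_modEq_sub_le {m : ℕ} (hm : Odd m) {a : ℤ}
    (ha : Int.gcd a m = 1) {X : ℕ} (hX : 1 ≤ X) :
    |((((negFundDiscrs X).filter (fun D => D ≡ a [ZMOD m])).card : ℕ) : ℝ)
        - 3 / (Real.pi ^ 2 * m) * (∏ p ∈ m.primeFactors, (1 - 1 / (p : ℝ) ^ 2)⁻¹) * X|
      ≤ 18 * Real.sqrt X := by
  have hm0 : m ≠ 0 := fun h => by simp [h] at hm
  -- coprimality data and the three residues
  have ha' : IsCoprime a m := Int.isCoprime_iff_gcd_eq_one.2 ha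
  have h2m : Nat.Coprime 2 m := Nat.coprime_two_left.2 hm
  have h4m : Nat.Coprime 4 m := by simpa using h2m.pow_left 2
  have h8m : IsCoprime (8 : ℤ) m := by
    have := Nat.isCoprime_iff_coprime.2 (h2m.pow_left 3); simpa using this
  have h4m' : IsCoprime (4 : ℤ) m := by
    have := Nat.isCoprime_iff_coprime.2 h4m; simpa using this
  obtain ⟨c₁, hc₁, h₁⟩ := exists_residue_modEq_iff h4m (r := 1) (s := 1) isCoprime_one_left
    isCoprime_one_left ha'
  obtain ⟨c₂, hc₂, h₂⟩ := exists_residue_modEq_iff h4m (r := 3) (s := 4)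
    ⟨-1, 1, by norm_num⟩ h4m' ha'
  obtain ⟨c₃, hc₃, h₃⟩ := exists_residue_modEq_iff h2m (r := 1) (s := 8) isCoprime_one_left
    h8m ha'
  -- the decomposition
  have hcard := card_negFundDiscrs_filter_modEq_eq X h₁ h₂ h₃
  -- the three counts
  set n₄ : ℤ := ((X : ℤ) - 1) / 4 with hn₄
  set n₈ : ℤ := ((X : ℤ) - 1) / 8 with hn₈
  have hn₄b : 4 * n₄ ≤ (X : ℤ) - 1 ∧ (X : ℤ) - 1 < 4 * n₄ + 4 := by omega
  have hn₈b : 8 * n₈ ≤ (X : ℤ) - 1 ∧ (X : ℤ) - 1 < 8 * n₈ + 8 := by omega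
  have hL4 : 0 < 4 * m := by omega
  have hL2 : 0 < 2 * m := by omega
  have e₁ := abs_card_squarefree_modEq_sub_le hL4 hc₁ (a := 1 - (X : ℤ)) (b := 0) (by omega)
    (Or.inl le_rfl) (M := X) (by omega) (by simp)
  have e₂ := abs_card_squarefree_modEq_sub_le hL4 hc₂ (a := -n₄) (b := 0) (by omega)
    (Or.inl le_rfl) (M := X) (by omega) (by simp)
  have e₃ := abs_card_squarefree_modEq_sub_le hL2 hc₃ (a := -n₈) (b := 0) (by omega)
    (Or.inl le_rfl) (M := X) (by omega) (by simp)
  -- the densities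
  have hg₄ : 6 / Real.pi ^ 2 * ∏ p ∈ (4 * m).primeFactors, (1 - 1 / (p : ℝ) ^ 2)⁻¹ =
      8 / Real.pi ^ 2 * ∏ p ∈ m.primeFactors, (1 - 1 / (p : ℝ) ^ 2)⁻¹ := by
    rw [show 4 * m = 2 ^ 2 * m by norm_num, prod_primeFactors_two_pow_mul hm two_ne_zero]; ring
  have hg₂ : 6 / Real.pi ^ 2 * ∏ p ∈ (2 * m).primeFactors, (1 - 1 / (p : ℝ) ^ 2)⁻¹ =
      8 / Real.pi ^ 2 * ∏ p ∈ m.primeFactors, (1 - 1 / (p : ℝ) ^ 2)⁻¹ := by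
    rw [show 2 * m = 2 ^ 1 * m by norm_num, prod_primeFactors_two_pow_mul hm one_ne_zero]; ring
  have hgle : 8 / Real.pi ^ 2 * ∏ p ∈ m.primeFactors, (1 - 1 / (p : ℝ) ^ 2)⁻¹ ≤ 2 := by
    rw [← hg₂]; exact density_le_two (by omega)
  have hg0 : 0 ≤ 8 / Real.pi ^ 2 * ∏ p ∈ m.primeFactors, (1 - 1 / (p : ℝ) ^ 2)⁻¹ := by
    rw [← hg₂]; exact density_nonneg _
  -- rewrite everything in terms of `g` and real numbers
  rw [hg₄] at e₁ e₂
  rw [hg₂] at e₃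
  set g := 8 / Real.pi ^ 2 * ∏ p ∈ m.primeFactors, (1 - 1 / (p : ℝ) ^ 2)⁻¹ with hg
  rw [hcard]
  push_cast at e₁ e₂ e₃ ⊢
  have hn₄r : 4 * (n₄ : ℝ) ≤ (X : ℝ) - 1 ∧ (X : ℝ) - 1 < 4 * (n₄ : ℝ) + 4 := by
    constructor <;> exact_mod_cast (by omega : _)
  have hn₈r : 8 * (n₈ : ℝ) ≤ (X : ℝ) - 1 ∧ (X : ℝ) - 1 < 8 * (n₈ : ℝ) + 8 := by
    constructor <;> exact_mod_cast (by omega : _)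
  have hsq1 : 1 ≤ Real.sqrt X := by
    rw [← Real.sqrt_one]; exact Real.sqrt_le_sqrt (by exact_mod_cast hX)
  have hmR : (1 : ℝ) ≤ m := by exact_mod_cast Nat.pos_of_ne_zero hm0
  rw [show (0 : ℝ) - (1 - (X : ℝ)) = (X : ℝ) - 1 by ring] at e₁
  rw [show (0 : ℝ) - -(n₄ : ℝ) = n₄ by ring] at e₂
  rw [show (0 : ℝ) - -(n₈ : ℝ) = n₈ by ring] at e₃
  have key : ((((Ico (1 - (X : ℤ)) 0).filter
        (fun x => x ≡ c₁ [ZMOD 4 * (m : ℤ)] ∧ Squarefree x)).card : ℕ) : ℝ)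
      + ((((Ico (-n₄) 0).filter (fun x => x ≡ c₂ [ZMOD 4 * (m : ℤ)] ∧ Squarefree x)).card : ℕ) : ℝ)
      + ((((Ico (-n₈) 0).filter (fun x => x ≡ c₃ [ZMOD 2 * (m : ℤ)] ∧ Squarefree x)).card : ℕ) : ℝ)
      - 3 / (Real.pi ^ 2 * m) * (∏ p ∈ m.primeFactors, (1 - 1 / (p : ℝ) ^ 2)⁻¹) * X =
      (((((Ico (1 - (X : ℤ)) 0).filter
          (fun x => x ≡ c₁ [ZMOD 4 * (m : ℤ)] ∧ Squarefree x)).card : ℕ) : ℝ)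
        - ((X : ℝ) - 1) / (4 * m) * g)
      + (((((Ico (-n₄) 0).filter (fun x => x ≡ c₂ [ZMOD 4 * (m : ℤ)] ∧ Squarefree x)).card : ℕ) : ℝ)
        - (n₄ : ℝ) / (4 * m) * g)
      + (((((Ico (-n₈) 0).filter (fun x => x ≡ c₃ [ZMOD 2 * (m : ℤ)] ∧ Squarefree x)).card : ℕ) : ℝ)
        - (n₈ : ℝ) / (2 * m) * g)
      + g / (4 * m) * (((X : ℝ) - 1) + n₄ + 2 * n₈ - 3 / 2 * X) := by
    rw [hg]; ring
  rw [key]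
  have hlast : |g / (4 * m) * (((X : ℝ) - 1) + n₄ + 2 * n₈ - 3 / 2 * X)| ≤ 5 / 2 := by
    rw [abs_mul, abs_of_nonneg (by positivity : 0 ≤ g / (4 * m))]
    have h1 : |((X : ℝ) - 1) + n₄ + 2 * n₈ - 3 / 2 * X| ≤ 5 := by
      rw [abs_le]; constructor <;> linarith [hn₄r.1, hn₄r.2, hn₈r.1, hn₈r.2]
    have h2 : g / (4 * m) ≤ 1 / 2 := by
      rw [div_le_iff₀ (by positivity)]; linarith
    calc g / (4 * m) * |((X : ℝ) - 1) + n₄ + 2 * n₈ - 3 / 2 * X| ≤ 1 / 2 * 5 :=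
        mul_le_mul h2 h1 (abs_nonneg _) (by norm_num)
      _ = 5 / 2 := by norm_num
  obtain ⟨l1, u1⟩ := abs_le.1 e₁
  obtain ⟨l2, u2⟩ := abs_le.1 e₂
  obtain ⟨l3, u3⟩ := abs_le.1 e₃
  obtain ⟨l4, u4⟩ := abs_le.1 hlast
  rw [abs_le]; constructor <;> linarith

end Literature.NumberTheory.QuadraticFields

end
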